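import Mathlib
import Literature.ModelTheory.ExponentialFields.DefinabilityParams
import Summits.Schanuel.Schanuel.Theorems.RigidCoreMinimalCounterexampleInAclHitSetArithmeticalRingDef
import Summits.Schanuel.Schanuel.Theorems.RigidCoreMinimalCounterexampleInAclHitSetArithmeticalGraphs

/-!
# REPRESENTABILITY: the graph of every partial recursive function is `∅`-definable in the ring `ℤ`
# (crux stmt-Schanuel-0969 `RigidCore.MinimalCounterexampleInAcl`, line kernel-arithmetic-selection, stub S8)

`--supports stmt-Schanuel-0969`; third layer under the registered stub `stub_corankOne_hitSetArithmetical` (S8: the hit pattern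
of a corank-one first failure is ring-definable over `ℤ`).  S8 = [the hit pattern is `Σ⁰₃` in computable data] +
[GÖDEL–KLEENE REPRESENTABILITY: recursive relations are arithmetical] + [arithmetical subsets of `ℤ^m` are ring-definable].
This file proves the middle conjunct for Mathlib's partial recursive functions:

* `ringDefinable_graph_of_partrec` — **if `Nat.Partrec f` then `Γ[f] = {(a, b) ∈ ℕ² : b ∈ f a} ⊆ ℤ²` is `∅`-definable in
  `(ℤ, +, ·, −, 0, 1)`** (any compatible ring-language structure), by induction on `Nat.Partrec`: each of the eight closure
  steps is the set identity of `…HitSetArithmeticalGraphs.lean` followed by the closure properties of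
  `…HitSetArithmeticalRingDef.lean` (pairing graph, β-graph, order, quantifiers over `ℤ`);
* registered form `ringDefinable_graph_of_partrec_std` (Mathlib's `FirstOrder.Ring.compatibleRingOfRing ℤ`).

Consequences for total computable functions, computable predicates and the arithmetical hierarchy over `ℤ^m` are drawn in
`…HitSetArithmeticalArithHierarchy.lean`.

References: K. Gödel, *Über formal unentscheidbare Sätze …*, Monatsh. Math. Phys. 38 (1931), Satz VII ("jede rekursive Relation
ist arithmetisch"); S. C. Kleene, *Introduction to Metamathematics* (1952), § 57 (normal form; μ-recursive = arithmetically
representable graphs); R. Kaye, *Models of Peano Arithmetic* (1991), Thm 3.3.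
-/

-- the summit namespace `Summit.Schanuel.Schanuel.…` repeats a component by design (D-0022)
set_option linter.dupNamespace false

open Set FirstOrder FirstOrder.Language

namespace Summit.Schanuel.Schanuel.Cruxes.MinimalCounterexampleInAcl.KernelArithmeticSelection

open Literature.ModelTheory.ExponentialFields

variable [FirstOrder.Ring.CompatibleRing ℤ] {α : Type*}

/-! ## Atoms: a definable relation at definable arguments -/

/-- A binary ring-definable relation `R ⊆ ℤ²` evaluated at two definable functions is a definable condition. [folklore] -/
theorem ringDefinable_atom₂ {R : Set (Fin 2 → ℤ)} (hR : (∅ : Set ℤ).Definable Language.ring R)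
    {f g : (α → ℤ) → ℤ} (hf : (∅ : Set ℤ).DefinableFun Language.ring f)
    (hg : (∅ : Set ℤ).DefinableFun Language.ring g) :
    (∅ : Set ℤ).Definable Language.ring {v : α → ℤ | ![f v, g v] ∈ R} :=
  hR.preimage_map (definableMap_vecCons hf (definableMap_vecCons hg definableMap_vecEmpty))

/-- A ternary ring-definable relation `R ⊆ ℤ³` evaluated at three definable functions is a definable condition. [folklore] -/
theorem ringDefinable_atom₃ {R : Set (Fin 3 → ℤ)} (hR : (∅ : Set ℤ).Definable Language.ring R)
    {f g h : (α → ℤ) → ℤ} (hf : (∅ : Set ℤ).DefinableFun Language.ring f)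
    (hg : (∅ : Set ℤ).DefinableFun Language.ring g) (hh : (∅ : Set ℤ).DefinableFun Language.ring h) :
    (∅ : Set ℤ).Definable Language.ring {v : α → ℤ | ![f v, g v, h v] ∈ R} :=
  hR.preimage_map (definableMap_vecCons hf (definableMap_vecCons hg (definableMap_vecCons hh definableMap_vecEmpty)))

/-! ## The eight closure steps -/

/-- zero. [folklore] -/
theorem ringDefinable_graph_zero : (∅ : Set ℤ).Definable Language.ring {t : Fin 2 → ℤ | 0 ≤ t 0 ∧ 0 ≤ t 1 ∧ (t 1).toNat ∈ (pure 0 : ℕ →. ℕ) (t 0).toNat} := by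
  rw [graph_zero_eq]
  exact definable_setOf_and_params (ringDefinable_setOf_nonneg (definableFun_proj_params _))
    (definable_setOf_eq_params (definableFun_proj_params _) ringDefinableFun_zero)

/-- succ. [folklore] -/
theorem ringDefinable_graph_succ : (∅ : Set ℤ).Definable Language.ring {t : Fin 2 → ℤ | 0 ≤ t 0 ∧ 0 ≤ t 1 ∧ (t 1).toNat ∈ (Nat.succ : ℕ →. ℕ) (t 0).toNat} := by
  rw [graph_succ_eq]
  exact definable_setOf_and_params (ringDefinable_setOf_nonneg (definableFun_proj_params _))
    (definable_setOf_eq_params (definableFun_proj_params _)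
      (ringDefinableFun_add (definableFun_proj_params _) ringDefinableFun_one))

/-- left. [folklore] -/
theorem ringDefinable_graph_left : (∅ : Set ℤ).Definable Language.ring {t : Fin 2 → ℤ | 0 ≤ t 0 ∧ 0 ≤ t 1 ∧ (t 1).toNat ∈ (↑fun n : ℕ => n.unpair.1 : ℕ →. ℕ) (t 0).toNat} := by
  rw [graph_left_eq]
  exact definable_setOf_exists_params (ringDefinable_atom₃ ringDefinable_natPairGraph (definableFun_proj_params _)
    (definableFun_proj_params _) (definableFun_proj_params _))

/-- right. [folklore] -/
theorem ringDefinable_graph_right : (∅ : Set ℤ).Definable Language.ring {t : Fin 2 → ℤ | 0 ≤ t 0 ∧ 0 ≤ t 1 ∧ (t 1).toNat ∈ (↑fun n : ℕ => n.unpair.2 : ℕ →. ℕ) (t 0).toNat} := by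
  rw [graph_right_eq]
  exact definable_setOf_exists_params (ringDefinable_atom₃ ringDefinable_natPairGraph (definableFun_proj_params _)
    (definableFun_proj_params _) (definableFun_proj_params _))

/-- pair. [folklore] -/
theorem ringDefinable_graph_pair {f g : ℕ →. ℕ} (hf : (∅ : Set ℤ).Definable Language.ring {t : Fin 2 → ℤ | 0 ≤ t 0 ∧ 0 ≤ t 1 ∧ (t 1).toNat ∈ f (t 0).toNat})
    (hg : (∅ : Set ℤ).Definable Language.ring {t : Fin 2 → ℤ | 0 ≤ t 0 ∧ 0 ≤ t 1 ∧ (t 1).toNat ∈ g (t 0).toNat}) :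
    (∅ : Set ℤ).Definable Language.ring {t : Fin 2 → ℤ | 0 ≤ t 0 ∧ 0 ≤ t 1 ∧ (t 1).toNat ∈ (fun n => Nat.pair <$> f n <*> g n : ℕ →. ℕ) (t 0).toNat} := by
  rw [graph_pair_eq]
  exact definable_setOf_existsBlock (definable_setOf_and_params
    (ringDefinable_atom₂ hf (definableFun_proj_params _) (definableFun_proj_params _))
    (definable_setOf_and_params
      (ringDefinable_atom₂ hg (definableFun_proj_params _) (definableFun_proj_params _))
      (ringDefinable_atom₃ ringDefinable_natPairGraph (definableFun_proj_params _) (definableFun_proj_params _)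
        (definableFun_proj_params _))))

/-- comp. [folklore] -/
theorem ringDefinable_graph_comp {f g : ℕ →. ℕ} (hf : (∅ : Set ℤ).Definable Language.ring {t : Fin 2 → ℤ | 0 ≤ t 0 ∧ 0 ≤ t 1 ∧ (t 1).toNat ∈ f (t 0).toNat})
    (hg : (∅ : Set ℤ).Definable Language.ring {t : Fin 2 → ℤ | 0 ≤ t 0 ∧ 0 ≤ t 1 ∧ (t 1).toNat ∈ g (t 0).toNat}) :
    (∅ : Set ℤ).Definable Language.ring {t : Fin 2 → ℤ | 0 ≤ t 0 ∧ 0 ≤ t 1 ∧ (t 1).toNat ∈ (fun n => g n >>= f : ℕ →. ℕ) (t 0).toNat} := by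
  rw [graph_comp_eq]
  exact definable_setOf_exists_params (definable_setOf_and_params
    (ringDefinable_atom₂ hg (definableFun_proj_params _) (definableFun_proj_params _))
    (ringDefinable_atom₂ hf (definableFun_proj_params _) (definableFun_proj_params _)))

/-- prec (Gödel's β-function step). [folklore] -/
theorem ringDefinable_graph_prec {f g : ℕ →. ℕ} (hf : (∅ : Set ℤ).Definable Language.ring {t : Fin 2 → ℤ | 0 ≤ t 0 ∧ 0 ≤ t 1 ∧ (t 1).toNat ∈ f (t 0).toNat})
    (hg : (∅ : Set ℤ).Definable Language.ring {t : Fin 2 → ℤ | 0 ≤ t 0 ∧ 0 ≤ t 1 ∧ (t 1).toNat ∈ g (t 0).toNat}) :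
    (∅ : Set ℤ).Definable Language.ring
      {t : Fin 2 → ℤ | 0 ≤ t 0 ∧ 0 ≤ t 1 ∧ (t 1).toNat ∈ (Nat.unpaired fun a n => n.rec (f a) fun y IH => do let i ← IH; g (Nat.pair a (Nat.pair y i)) : ℕ →. ℕ) (t 0).toNat} := by
  rw [graph_prec_eq]
  refine definable_setOf_existsBlock (definable_setOf_and_params ?_ (definable_setOf_and_params ?_
    (definable_setOf_and_params ?_ ?_)))
  · exact ringDefinable_atom₃ ringDefinable_natPairGraph (definableFun_proj_params _) (definableFun_proj_params _)
      (definableFun_proj_params _)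
  · exact definable_setOf_exists_params (definable_setOf_and_params
      (ringDefinable_atom₃ ringDefinable_natBetaGraph (definableFun_proj_params _) ringDefinableFun_zero
        (definableFun_proj_params _))
      (ringDefinable_atom₂ hf (definableFun_proj_params _) (definableFun_proj_params _)))
  · exact ringDefinable_atom₃ ringDefinable_natBetaGraph (definableFun_proj_params _) (definableFun_proj_params _)
      (definableFun_proj_params _)
  · refine definable_setOf_forall_params (definable_setOf_imp_params
      (ringDefinable_setOf_nonneg (definableFun_proj_params _)) (definable_setOf_imp_params
      (ringDefinable_setOf_lt (definableFun_proj_params _) (definableFun_proj_params _))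
      (definable_setOf_existsBlock (definable_setOf_and_params ?_ (definable_setOf_and_params ?_
        (definable_setOf_and_params ?_ (definable_setOf_and_params ?_ ?_)))))))
    · exact ringDefinable_atom₃ ringDefinable_natBetaGraph (definableFun_proj_params _) (definableFun_proj_params _)
        (definableFun_proj_params _)
    · exact ringDefinable_atom₃ ringDefinable_natBetaGraph (definableFun_proj_params _)
        (ringDefinableFun_add (definableFun_proj_params _) ringDefinableFun_one) (definableFun_proj_params _)
    · exact ringDefinable_atom₃ ringDefinable_natPairGraph (definableFun_proj_params _) (definableFun_proj_params _)
        (definableFun_proj_params _)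
    · exact ringDefinable_atom₃ ringDefinable_natPairGraph (definableFun_proj_params _) (definableFun_proj_params _)
        (definableFun_proj_params _)
    · exact ringDefinable_atom₂ hg (definableFun_proj_params _) (definableFun_proj_params _)

/-- rfind (Kleene minimisation). [folklore] -/
theorem ringDefinable_graph_rfind {f : ℕ →. ℕ} (hf : (∅ : Set ℤ).Definable Language.ring {t : Fin 2 → ℤ | 0 ≤ t 0 ∧ 0 ≤ t 1 ∧ (t 1).toNat ∈ f (t 0).toNat}) :
    (∅ : Set ℤ).Definable Language.ring {t : Fin 2 → ℤ | 0 ≤ t 0 ∧ 0 ≤ t 1 ∧ (t 1).toNat ∈ (fun a => Nat.rfind fun n => (fun m => m = 0) <$> f (Nat.pair a n) : ℕ →. ℕ) (t 0).toNat} := by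
  rw [graph_rfind_eq]
  refine definable_setOf_and_params (ringDefinable_setOf_nonneg (definableFun_proj_params _))
    (definable_setOf_and_params ?_ ?_)
  · exact definable_setOf_exists_params (definable_setOf_and_params
      (ringDefinable_atom₃ ringDefinable_natPairGraph (definableFun_proj_params _) (definableFun_proj_params _)
        (definableFun_proj_params _))
      (ringDefinable_atom₂ hf (definableFun_proj_params _) ringDefinableFun_zero))
  · refine definable_setOf_forall_params (definable_setOf_imp_params
      (ringDefinable_setOf_nonneg (definableFun_proj_params _)) (definable_setOf_imp_params
      (ringDefinable_setOf_lt (definableFun_proj_params _) (definableFun_proj_params _))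
      (definable_setOf_existsBlock (definable_setOf_and_params ?_ (definable_setOf_and_params ?_ ?_)))))
    · exact ringDefinable_atom₃ ringDefinable_natPairGraph (definableFun_proj_params _) (definableFun_proj_params _)
        (definableFun_proj_params _)
    · exact ringDefinable_atom₂ hf (definableFun_proj_params _) (definableFun_proj_params _)
    · exact ringDefinable_setOf_ne (definableFun_proj_params _) ringDefinableFun_zero

/-! ## The representability theorem -/

/-- **REPRESENTABILITY (Gödel 1931, Satz VII; Kleene).**  The graph `{(a, b) ∈ ℕ² : b ∈ f a}`, placed inside `ℤ²`, of every
partial recursive function `f : ℕ →. ℕ` (Mathlib `Nat.Partrec f`) is `∅`-definable in the ring `ℤ` — for any compatible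
ring-language structure on `ℤ`.  Induction on `Nat.Partrec` through the eight closure steps above. [folklore] -/
theorem ringDefinable_graph_of_partrec {f : ℕ →. ℕ} (hf : Nat.Partrec f) :
    (∅ : Set ℤ).Definable Language.ring {t : Fin 2 → ℤ | 0 ≤ t 0 ∧ 0 ≤ t 1 ∧ (t 1).toNat ∈ f (t 0).toNat} := by
  induction hf with
  | zero => exact ringDefinable_graph_zero
  | succ => exact ringDefinable_graph_succ
  | left => exact ringDefinable_graph_left
  | right => exact ringDefinable_graph_right
  | pair _ _ ihf ihg => exact ringDefinable_graph_pair ihf ihg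
  | comp _ _ ihf ihg => exact ringDefinable_graph_comp ihf ihg
  | prec _ _ ihf ihg => exact ringDefinable_graph_prec ihf ihg
  | rfind _ ih => exact ringDefinable_graph_rfind ih

/-- The graph of a partial recursive function at NATURAL-NUMBER quantified arguments: `{(a, b) : ℕ-points}` phrased with
`∃ a b : ℕ` instead of `Int.toNat`, the form used downstream. [folklore] -/
theorem ringDefinable_natGraph_of_partrec {f : ℕ →. ℕ} (hf : Nat.Partrec f) :
    (∅ : Set ℤ).Definable Language.ring {v : Fin 2 → ℤ | ∃ a b : ℕ, v 0 = a ∧ v 1 = b ∧ b ∈ f a} := by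
  convert ringDefinable_graph_of_partrec hf using 1
  ext v
  simp only [mem_setOf_eq]
  constructor
  · rintro ⟨a, b, ha, hb, h⟩
    rw [ha, hb]; simp only [Int.toNat_natCast]; exact ⟨Int.natCast_nonneg _, Int.natCast_nonneg _, h⟩
  · rintro ⟨h0, h1, h⟩
    exact ⟨(v 0).toNat, (v 1).toNat, (Int.toNat_of_nonneg h0).symm, (Int.toNat_of_nonneg h1).symm, h⟩

omit [FirstOrder.Ring.CompatibleRing ℤ] in
/-- Registered helper stub `ringDefinable_graph_of_partrec_std` of crux stmt-Schanuel-0969 (line kernel-arithmetic-selection,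
S8): **the graph of every partial recursive function is `∅`-definable in the ring `ℤ`** with Mathlib's standard structure
`FirstOrder.Ring.compatibleRingOfRing ℤ` (Gödel 1931 Satz VII / Kleene). [folklore] -/
theorem ringDefinable_graph_of_partrec_std : ∀ (f : ℕ →. ℕ), Nat.Partrec f → (letI := FirstOrder.Ring.compatibleRingOfRing ℤ; (∅ : Set ℤ).Definable FirstOrder.Language.ring {v : Fin 2 → ℤ | ∃ a b : ℕ, v 0 = a ∧ v 1 = b ∧ b ∈ f a}) := by
  intro f hf
  letI := FirstOrder.Ring.compatibleRingOfRing ℤ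
  exact ringDefinable_natGraph_of_partrec hf

end Summit.Schanuel.Schanuel.Cruxes.MinimalCounterexampleInAcl.KernelArithmeticSelection
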